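import Summits.BirchSwinnertonDyer.Rank1Residual.X5.KatoOrdTwoTowerGapIff
import Mathlib.GroupTheory.Index
import HarnessLib

/-!
# The TOWER STAIRCASE (part 1): the layer counts `#(X/(p,T^j)X)` of a finitely generated `Λ = ℤ_p⟦T⟧`-module are
# LOG-CONCAVE, `p`-dichotomous, and FROZEN at `#(X/pX)` by the first stall — the next glue lemma of the layer-count road
# (crux Kμ⁺ `SignedMuVanishingAtTwoPlus` stmt-BirchSwinnertonDyer-20689, seed `SignedMuSeedAtTwoPlus` stmt-21438, route `ResidualThetaTransportAtTwo`)

Cell `bsd-wall`, width seat `bsd-wall-rtt-p4-w2` (g12). THEOREMS ONLY (no `def`, no named fact, no `sorry`); pure commutative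
algebra over `Λ = ℤ_p⟦T⟧` for EVERY prime `p`, on top of the cell-`b2b` TOWER-GAP lemma (`Summit.BirchSwinnertonDyer.Rank1Residual.X5.TowerGap`, files `TwoAdicTargetsTowerGap{,End}`, `KatoOrdTwoTowerGapIff`:
`towerIdeal p j = (p, T^j)`, `xPowSubmodule p N j = T^j N`, `modPSubmodule p X = pX`, `finite_modP_of_card_quotient_lt` — ONE slack
block of layers makes `X/pX` finite); `--supports` the crux as a helper; nothing about any curve is asserted; BSD is not proved by this.

WHY. The lead's ε/d_n-test on the seed line (crux workfiles `Cruxes/SignedMuVanishingAtTwoPlus/EpsCertificate406203s1.md`,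
`Cruxes/SignedMuSeedAtTwoPlus/IDEATION-CENSUS-k2g16.md` §2 (e)) reads the 2-ranks `d_n = dim X/(2, ω_n)X` of ONE tower; so far the tree
certifies `μ = 0` from one slack block (gap lemma) and knows the exact layer law for CYCLIC `X` only (w2 g11 `…GrasLambdaCyclicPresentation`).
Here cyclicity and the structure theorem are removed from the whole staircase:

* §1 numerics of a positive LOG-CONCAVE sequence (`c (j+2) · c j ≤ c (j+1)²`): later step ratios never exceed earlier ones
  (`mul_le_mul_of_logConcave`), the three-term inequality **`c a ^ (d−b) · c d ^ (b−a) ≤ c b ^ (d−a)`** (`pow_mul_pow_le_pow_of_logConcave`),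
  `c m ≤ c 1 ^ m`; a STALL `c (j+1) = c j` of a monotone log-concave sequence is final (`eq_of_stall`); under the `p`-dichotomy
  «a step is trivial or multiplies by ≥ p» a sub-maximal block `c (m+k) < p^k · c m` contains a stall (`exists_stall_of_lt`).
* §2 the HILBERT–SAMUEL STAIRCASE of the `T`-adic filtration of any `Λ`-module `N`: multiplication by `T` maps `T^j N` ONTO `T^{j+1} N`
  and `T^{j+1} N` into `T^{j+2} N`, so the unit-step indices `e_j = [T^j N : T^{j+1} N]` satisfy **`e_{j+1} ∣ e_j`**
  (`relIndex_xPowSubmodule_succ_dvd`); a stall `T^{j+1}N = T^jN` kills `T^i N` for all `i ≥ j` (Nakayama).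
* §3 the layer counts `c j = #(X/(p,T^j)X)` of a f.g. `Λ`-module `X` (`= [X/pX : T^j(X/pX)]`): positive, `c j ∣ c (j+1)`,
  **LOG-CONCAVE** (`natCard_layer_logConcave`), **`p`-DICHOTOMOUS** (`natCard_layer_succ_eq_or_dvd`: `c (j+1) = c j` or
  `p · c j ∣ c (j+1)`), and **a stall FREEZES them at the exact value `#(X/pX)`** (`finite_modP_and_natCard_eq_of_stall`).

Part 2 (`…TowerStaircaseReading`) draws the consumers: three-term log-concavity of the counts, freezing and `#(X/pX) = c (m+k)` from
one slack block, the `λ`-reading `p^{λ(X)} ≤ c (m+k)`, the layer forms `L (n+2) · L n ^ p ≤ L (n+1) ^ (p+1)` (`L n = #(X/(p, ω_n)X)`)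
and stationarity from the first sub-maximal layer step, and the Kobayashi-currency certificate.

References: [Washington1997] §13.2–13.3 (Lemma 13.16, Props. 13.19–13.22); [Fukuda1994] T. Fukuda, Proc. Japan Acad. 70 (1994) Thm. 1;
[NeukirchSchmidtWingberg2008] (5.3.10), (5.3.17); [GreenbergLNM1716] §3 and p. 136; [Matsumura1987] §13 (Hilbert–Samuel functions), Thm. 8.4.
-/

set_option autoImplicit false
set_option linter.dupNamespace false

noncomputable section

open scoped Classical Pointwise

open Literature.NumberTheory.EllipticCurves Summit.BirchSwinnertonDyer.Rank1Residual.X5.TowerGap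

namespace Summit.BirchSwinnertonDyer.BirchSwinnertonDyer.Theorems.SignedMuAtTwo.TowerStaircase

/-! ## §1 Numerics of a positive log-concave sequence -/

section Numerics

variable {c : ℕ → ℕ}

/-- Later step ratios never exceed earlier ones: `c (j+2) c j ≤ c (j+1)²` for all `j` gives
`c (j+k+1) · c j ≤ c (j+1) · c (j+k)`, i.e. `c(j+k+1)/c(j+k) ≤ c(j+1)/c(j)`. [folklore] -/
theorem mul_le_mul_of_logConcave (hpos : ∀ j, 0 < c j) (hlc : ∀ j, c (j + 2) * c j ≤ c (j + 1) ^ 2)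
    (j k : ℕ) : c (j + k + 1) * c j ≤ c (j + 1) * c (j + k) := by
  induction k with
  | zero => simp
  | succ k ih =>
    have h1 := hlc (j + k)
    have key : (c (j + k + 2) * c j) * (c (j + k) * c (j + k + 1)) ≤
        (c (j + 1) * c (j + k + 1)) * (c (j + k) * c (j + k + 1)) := by
      calc (c (j + k + 2) * c j) * (c (j + k) * c (j + k + 1))
          = (c (j + k + 2) * c (j + k)) * (c (j + k + 1) * c j) := by ring
        _ ≤ c (j + k + 1) ^ 2 * (c (j + 1) * c (j + k)) := Nat.mul_le_mul h1 ih
        _ = (c (j + 1) * c (j + k + 1)) * (c (j + k) * c (j + k + 1)) := by ring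
    have := Nat.le_of_mul_le_mul_right key (Nat.mul_pos (hpos _) (hpos _))
    simpa [add_assoc] using this

/-- The same with two indices `i ≤ j`: `c (j+1) · c i ≤ c (i+1) · c j`. [folklore] -/
theorem mul_le_mul_of_logConcave' (hpos : ∀ j, 0 < c j) (hlc : ∀ j, c (j + 2) * c j ≤ c (j + 1) ^ 2)
    {i j : ℕ} (hij : i ≤ j) : c (j + 1) * c i ≤ c (i + 1) * c j := by
  obtain ⟨k, rfl⟩ := Nat.exists_eq_add_of_le hij
  exact mul_le_mul_of_logConcave hpos hlc i k

/-- One late step to the power `n` is dominated by `n` early steps: for `a + n ≤ j`,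
`c a · c (j+1) ^ n ≤ c (a+n) · c j ^ n`. [folklore] -/
theorem mul_pow_le_mul_pow_of_logConcave (hpos : ∀ j, 0 < c j)
    (hlc : ∀ j, c (j + 2) * c j ≤ c (j + 1) ^ 2) :
    ∀ (n a j : ℕ), a + n ≤ j → c a * c (j + 1) ^ n ≤ c (a + n) * c j ^ n := by
  intro n
  induction n with
  | zero => intro a j _; simp
  | succ n ih =>
    intro a j haj
    have h1 : c (a + 1) * c (j + 1) ^ n ≤ c (a + 1 + n) * c j ^ n := ih (a + 1) j (by omega)
    have h2 : c (j + 1) * c a ≤ c (a + 1) * c j := mul_le_mul_of_logConcave' hpos hlc (by omega)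
    have key : c (a + 1) * (c a * c (j + 1) ^ (n + 1)) ≤ c (a + 1) * (c (a + (n + 1)) * c j ^ (n + 1)) := by
      calc c (a + 1) * (c a * c (j + 1) ^ (n + 1))
          = (c (a + 1) * c (j + 1) ^ n) * (c (j + 1) * c a) := by ring
        _ ≤ (c (a + 1 + n) * c j ^ n) * (c (a + 1) * c j) := Nat.mul_le_mul h1 h2
        _ = c (a + 1) * (c (a + (n + 1)) * c j ^ (n + 1)) := by
          rw [show a + 1 + n = a + (n + 1) by omega]; ring
    exact Nat.le_of_mul_le_mul_left key (hpos _)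

/-- Blocks: for `a ≤ b` and every `n`, `c a ^ n · c (b+n) ^ (b−a) ≤ c b ^ (n + (b − a))`. [folklore] -/
theorem pow_mul_pow_le_pow_of_logConcave_aux (hpos : ∀ j, 0 < c j)
    (hlc : ∀ j, c (j + 2) * c j ≤ c (j + 1) ^ 2) {a b : ℕ} (hab : a ≤ b) :
    ∀ n : ℕ, c a ^ n * c (b + n) ^ (b - a) ≤ c b ^ (n + (b - a)) := by
  intro n
  induction n with
  | zero => simp
  | succ n ih =>
    -- one more late step: `c a · c (b+n+1)^(b−a) ≤ c b · c (b+n)^(b−a)`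
    have hstep : c a * c (b + n + 1) ^ (b - a) ≤ c (a + (b - a)) * c (b + n) ^ (b - a) :=
      mul_pow_le_mul_pow_of_logConcave hpos hlc (b - a) a (b + n) (by omega)
    rw [show a + (b - a) = b by omega] at hstep
    calc c a ^ (n + 1) * c (b + (n + 1)) ^ (b - a)
        = c a ^ n * (c a * c (b + n + 1) ^ (b - a)) := by rw [← add_assoc]; ring
      _ ≤ c a ^ n * (c b * c (b + n) ^ (b - a)) := Nat.mul_le_mul_left _ hstep
      _ = c b * (c a ^ n * c (b + n) ^ (b - a)) := by ring
      _ ≤ c b * c b ^ (n + (b - a)) := Nat.mul_le_mul_left _ ih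
      _ = c b ^ (n + 1 + (b - a)) := by ring

/-- **Three-term log-concavity.** For a positive sequence with `c (j+2) c j ≤ c (j+1)²` and `a ≤ b ≤ d`:
`c a ^ (d − b) · c d ^ (b − a) ≤ c b ^ (d − a)` — the geometric-mean form of «`log c` is concave». [folklore] -/
theorem pow_mul_pow_le_pow_of_logConcave (hpos : ∀ j, 0 < c j)
    (hlc : ∀ j, c (j + 2) * c j ≤ c (j + 1) ^ 2) {a b d : ℕ} (hab : a ≤ b) (hbd : b ≤ d) :
    c a ^ (d - b) * c d ^ (b - a) ≤ c b ^ (d - a) := by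
  have h := pow_mul_pow_le_pow_of_logConcave_aux hpos hlc hab (d - b)
  rwa [show b + (d - b) = d by omega, show d - b + (b - a) = d - a by omega] at h

/-- With `c 0 = 1`: `c m ≤ c 1 ^ m` (the case `a = 0`, `b = 1`, `d = m`). [folklore] -/
theorem le_pow_of_logConcave (hpos : ∀ j, 0 < c j) (hlc : ∀ j, c (j + 2) * c j ≤ c (j + 1) ^ 2)
    (h0 : c 0 = 1) (m : ℕ) : c m ≤ c 1 ^ m := by
  rcases Nat.eq_zero_or_pos m with rfl | hm
  · simp [h0]
  have h := pow_mul_pow_le_pow_of_logConcave hpos hlc (Nat.zero_le 1) hm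
  simpa [h0] using h

/-- Forward bound: `c (b+n) · c b ^ n ≤ c (b+1) ^ n · c b` — growth after `b` is at most the step at `b`, per step.
[folklore] -/
theorem mul_pow_le_pow_mul_of_logConcave (hpos : ∀ j, 0 < c j)
    (hlc : ∀ j, c (j + 2) * c j ≤ c (j + 1) ^ 2) (b n : ℕ) :
    c (b + n) * c b ^ n ≤ c (b + 1) ^ n * c b := by
  induction n with
  | zero => simp
  | succ n ih =>
    have h1 := mul_le_mul_of_logConcave hpos hlc b n
    calc c (b + (n + 1)) * c b ^ (n + 1) = (c (b + n + 1) * c b) * c b ^ n := by rw [← add_assoc]; ring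
      _ ≤ (c (b + 1) * c (b + n)) * c b ^ n := Nat.mul_le_mul_right _ h1
      _ = c (b + 1) * (c (b + n) * c b ^ n) := by ring
      _ ≤ c (b + 1) * (c (b + 1) ^ n * c b) := Nat.mul_le_mul_left _ ih
      _ = c (b + 1) ^ (n + 1) * c b := by ring

/-- **A stall is final.** For a monotone positive log-concave sequence, `c (j+1) = c j` forces `c i = c j` for every
`i ≥ j`. [folklore] -/
theorem eq_of_stall (hpos : ∀ j, 0 < c j) (hlc : ∀ j, c (j + 2) * c j ≤ c (j + 1) ^ 2)
    (hmono : ∀ j, c j ≤ c (j + 1)) {j : ℕ} (hstall : c (j + 1) = c j) {i : ℕ} (hij : j ≤ i) :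
    c i = c j := by
  obtain ⟨k, rfl⟩ := Nat.exists_eq_add_of_le hij
  induction k with
  | zero => rfl
  | succ k ih =>
    have h := mul_le_mul_of_logConcave hpos hlc j k
    rw [hstall, ih (Nat.le_add_right j k)] at h
    -- `c (j+k+1) * c j ≤ c j * c j`
    have hle : c (j + k + 1) ≤ c j := Nat.le_of_mul_le_mul_right h (hpos j)
    have hge : c j ≤ c (j + k + 1) := (ih (Nat.le_add_right j k)).symm.le.trans (hmono _)
    rw [← add_assoc]
    exact le_antisymm hle hge

/-- **The `p`-dichotomy makes full blocks multiply by `p^k`**: if every step is a stall or multiplies the count by at least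
`p`, and no step in `[m, m+k)` stalls, then `p^k · c m ≤ c (m+k)`. [folklore] -/
theorem pow_mul_le_of_forall_ne {p : ℕ} (hd : ∀ j, c (j + 1) = c j ∨ p * c j ≤ c (j + 1)) (m : ℕ) :
    ∀ k : ℕ, (∀ j < k, c (m + j + 1) ≠ c (m + j)) → p ^ k * c m ≤ c (m + k) := by
  intro k
  induction k with
  | zero => intro _; simp
  | succ k ih =>
    intro hne
    have h1 : p ^ k * c m ≤ c (m + k) := ih fun j hj => hne j (Nat.lt_succ_of_lt hj)
    have h2 : p * c (m + k) ≤ c (m + k + 1) :=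
      (hd (m + k)).resolve_left (hne k k.lt_succ_self)
    calc p ^ (k + 1) * c m = p * (p ^ k * c m) := by ring
      _ ≤ p * c (m + k) := Nat.mul_le_mul_left _ h1
      _ ≤ c (m + (k + 1)) := by rw [← add_assoc]; exact h2

/-- **A sub-maximal block contains a stall**: under the `p`-dichotomy, `c (m+k) < p^k · c m` forces `c (m+j+1) = c (m+j)` for
some `j < k`. [folklore] -/
theorem exists_stall_of_lt {p : ℕ} (hd : ∀ j, c (j + 1) = c j ∨ p * c j ≤ c (j + 1)) {m k : ℕ}
    (hlt : c (m + k) < p ^ k * c m) : ∃ j < k, c (m + j + 1) = c (m + j) := by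
  by_contra hcon
  push Not at hcon
  exact absurd (pow_mul_le_of_forall_ne hd m k hcon) (not_le.mpr hlt)

end Numerics

/-! ## §2 The Hilbert–Samuel staircase of the `T`-adic filtration `T^j N` -/

section Staircase

variable (p : ℕ) [hp : Fact p.Prime] {N : Type*} [AddCommGroup N] [Module (IwasawaAlgebra p) N]

/-- `T^{j+1} N = (T) · T^j N`. [folklore] -/
theorem xPowSubmodule_succ (j : ℕ) :
    xPowSubmodule p N (j + 1) = Ideal.span {(PowerSeries.X : IwasawaAlgebra p)} • xPowSubmodule p N j := by
  simp only [xPowSubmodule, pow_succ', Submodule.mul_smul]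

/-- `x ∈ T^j N ⇒ T·x ∈ T^{j+1} N`. [folklore] -/
theorem X_smul_mem_xPowSubmodule_succ {j : ℕ} {x : N} (hx : x ∈ xPowSubmodule p N j) :
    (PowerSeries.X : IwasawaAlgebra p) • x ∈ xPowSubmodule p N (j + 1) := by
  rw [xPowSubmodule_succ]
  exact Submodule.smul_mem_smul (Ideal.mem_span_singleton_self _) hx

/-- **Multiplication by `T` maps `T^j N` ONTO `T^{j+1} N`**: every `y ∈ T^{j+1}N` is `T·x` with `x ∈ T^j N`. [folklore] -/
theorem exists_X_smul_eq_of_mem_xPowSubmodule_succ {j : ℕ} {y : N} (hy : y ∈ xPowSubmodule p N (j + 1)) :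
    ∃ x ∈ xPowSubmodule p N j, (PowerSeries.X : IwasawaAlgebra p) • x = y := by
  rw [xPowSubmodule_succ, Submodule.ideal_span_singleton_smul, Submodule.mem_smul_pointwise_iff_exists] at hy
  exact hy

/-- A stall of the filtration is final: `T^{j+1} N = T^j N` with `N` finitely generated forces `T^i N = 0` for all
`i ≥ j` (Nakayama, `T ∈ 𝔪_Λ`). [folklore] -/
theorem xPowSubmodule_eq_bot_of_le [Module.Finite (IwasawaAlgebra p) N] {j : ℕ}
    (h : xPowSubmodule p N (j + 1) = xPowSubmodule p N j) {i : ℕ} (hij : j ≤ i) :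
    xPowSubmodule p N i = ⊥ :=
  le_bot_iff.mp ((xPowSubmodule_antitone p N hij).trans (xPowSubmodule_eq_bot_of_eq_succ p h).le)

/-- **The staircase (Hilbert–Samuel monotonicity of the `T`-adic filtration, no structure theorem).** The unit-step indices
`e_j = [T^j N : T^{j+1} N]` (relative indices of the underlying additive groups; `0` when infinite) satisfy
`e_{j+1} ∣ e_j`: multiplication by `T` is a surjection `T^j N ↠ T^{j+1} N` carrying `T^{j+1} N` into `T^{j+2} N`, so it
induces a surjection `T^j N / T^{j+1} N ↠ T^{j+1} N / T^{j+2} N`. [cite: Matsumura1987, §13 (Hilbert–Samuel functions)] -/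
theorem relIndex_xPowSubmodule_succ_dvd (j : ℕ) :
    (xPowSubmodule p N (j + 2)).toAddSubgroup.relIndex (xPowSubmodule p N (j + 1)).toAddSubgroup ∣
      (xPowSubmodule p N (j + 1)).toAddSubgroup.relIndex (xPowSubmodule p N j).toAddSubgroup := by
  set K : AddSubgroup N := (xPowSubmodule p N j).toAddSubgroup with hK
  set K' : AddSubgroup N := (xPowSubmodule p N (j + 1)).toAddSubgroup with hK'
  set K'' : AddSubgroup N := (xPowSubmodule p N (j + 2)).toAddSubgroup with hK''
  -- multiplication by `T`, restricted to `T^j N → T^{j+1} N`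
  let F : N →+ N := DistribSMul.toAddMonoidHom N (PowerSeries.X : IwasawaAlgebra p)
  have hF : ∀ x : K, F.restrict K x ∈ K' := fun x =>
    X_smul_mem_xPowSubmodule_succ p (j := j) x.2
  let φ : K →+ K' := (F.restrict K).codRestrict K' hF
  have hφ : ∀ x : K, ((φ x : K') : N) = (PowerSeries.X : IwasawaAlgebra p) • (x : N) := fun _ => rfl
  have hsurj : Function.Surjective φ := by
    rintro ⟨y, hy⟩
    obtain ⟨x, hx, hxy⟩ := exists_X_smul_eq_of_mem_xPowSubmodule_succ p (j := j) hy
    exact ⟨⟨x, hx⟩, Subtype.ext (by rw [hφ]; exact hxy)⟩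
  -- the image of `T^{j+1}N ∩ T^jN` lies in `T^{j+2}N ∩ T^{j+1}N`
  have hmap : (K'.addSubgroupOf K).map φ ≤ K''.addSubgroupOf K' := by
    intro y hy
    obtain ⟨x, hx, rfl⟩ := AddSubgroup.mem_map.mp hy
    rw [AddSubgroup.mem_addSubgroupOf] at hx ⊢
    change ((φ x : K') : N) ∈ xPowSubmodule p N (j + 2)
    rw [hφ]
    exact X_smul_mem_xPowSubmodule_succ p (j := j + 1) hx
  calc K''.relIndex K' = (K''.addSubgroupOf K').index := rfl
    _ ∣ ((K'.addSubgroupOf K).map φ).index := AddSubgroup.index_dvd_of_le hmap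
    _ ∣ (K'.addSubgroupOf K).index := AddSubgroup.index_map_dvd _ hsurj
    _ = K'.relIndex K := rfl

end Staircase

/-! ## §3 The layer counts `c j = #(X/(p,T^j)X)` of a finitely generated `Λ`-module -/

section Layers

variable (p : ℕ) [hp : Fact p.Prime] {M : Type*} [AddCommGroup M] [Module (IwasawaAlgebra p) M]
  [Module.Finite (IwasawaAlgebra p) M]

omit [Module.Finite (IwasawaAlgebra p) M] in
/-- `#(X/(p,T^j)X) = [X/pX : T^j(X/pX)]` (third isomorphism theorem, `TowerGap.quotientTowerIdealEquiv`). [folklore] -/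
theorem natCard_layer_eq_index (j : ℕ) :
    Nat.card (M ⧸ (towerIdeal p j • ⊤ : Submodule (IwasawaAlgebra p) M)) =
      (xPowSubmodule p (M ⧸ modPSubmodule p M) j).toAddSubgroup.index := by
  rw [Nat.card_congr (quotientTowerIdealEquiv p (M := M) j).toEquiv, natCard_quotient_eq_index]

/-- The layer counts are positive (the quotients are finite and non-empty). [folklore] -/
theorem natCard_layer_pos (j : ℕ) : 0 < Nat.card (M ⧸ (towerIdeal p j • ⊤ : Submodule (IwasawaAlgebra p) M)) :=
  haveI := finite_quotient_towerIdeal p (M := M) j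
  Nat.card_pos

omit [Module.Finite (IwasawaAlgebra p) M] in
/-- **One step = one index**: `#(X/(p,T^{j+1})X) = e_j · #(X/(p,T^j)X)` with `e_j = [T^j N : T^{j+1} N]`, `N = X/pX`.
[folklore] -/
theorem natCard_layer_succ_eq (j : ℕ) :
    Nat.card (M ⧸ (towerIdeal p (j + 1) • ⊤ : Submodule (IwasawaAlgebra p) M)) =
      (xPowSubmodule p (M ⧸ modPSubmodule p M) (j + 1)).toAddSubgroup.relIndex
          (xPowSubmodule p (M ⧸ modPSubmodule p M) j).toAddSubgroup *
        Nat.card (M ⧸ (towerIdeal p j • ⊤ : Submodule (IwasawaAlgebra p) M)) := by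
  rw [natCard_layer_eq_index, natCard_layer_eq_index, AddSubgroup.relIndex_mul_index]
  exact fun x hx => xPowSubmodule_antitone p _ (Nat.le_succ j) hx

omit [Module.Finite (IwasawaAlgebra p) M] in
/-- The layer counts divide each other upward: `#(X/(p,T^j)X) ∣ #(X/(p,T^{j+1})X)`. [folklore] -/
theorem natCard_layer_dvd_succ (j : ℕ) :
    Nat.card (M ⧸ (towerIdeal p j • ⊤ : Submodule (IwasawaAlgebra p) M)) ∣
      Nat.card (M ⧸ (towerIdeal p (j + 1) • ⊤ : Submodule (IwasawaAlgebra p) M)) :=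
  ⟨_, by rw [natCard_layer_succ_eq, mul_comm]⟩

/-- The layer counts are monotone. [folklore] -/
theorem natCard_layer_mono (j : ℕ) :
    Nat.card (M ⧸ (towerIdeal p j • ⊤ : Submodule (IwasawaAlgebra p) M)) ≤
      Nat.card (M ⧸ (towerIdeal p (j + 1) • ⊤ : Submodule (IwasawaAlgebra p) M)) :=
  Nat.le_of_dvd (natCard_layer_pos p (j + 1)) (natCard_layer_dvd_succ p j)

/-- The unit-step index `e_j` is non-zero (the layer counts are finite). [folklore] -/
theorem relIndex_layer_ne_zero (j : ℕ) :
    (xPowSubmodule p (M ⧸ modPSubmodule p M) (j + 1)).toAddSubgroup.relIndex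
        (xPowSubmodule p (M ⧸ modPSubmodule p M) j).toAddSubgroup ≠ 0 := by
  intro h
  have := natCard_layer_succ_eq p (M := M) j
  rw [h, zero_mul] at this
  exact (natCard_layer_pos p (M := M) (j + 1)).ne' this

/-- **LOG-CONCAVITY of the layer counts**: `#(X/(p,T^{j+2})X) · #(X/(p,T^j)X) ≤ #(X/(p,T^{j+1})X)²` for every finitely
generated `Λ`-module `X` (the staircase `e_{j+1} ∣ e_j`). [folklore] -/
theorem natCard_layer_logConcave (j : ℕ) :
    Nat.card (M ⧸ (towerIdeal p (j + 2) • ⊤ : Submodule (IwasawaAlgebra p) M)) *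
        Nat.card (M ⧸ (towerIdeal p j • ⊤ : Submodule (IwasawaAlgebra p) M)) ≤
      Nat.card (M ⧸ (towerIdeal p (j + 1) • ⊤ : Submodule (IwasawaAlgebra p) M)) ^ 2 := by
  have hdvd := relIndex_xPowSubmodule_succ_dvd p (N := M ⧸ modPSubmodule p M) j
  have hle := Nat.le_of_dvd (Nat.pos_of_ne_zero (relIndex_layer_ne_zero p (M := M) j)) hdvd
  rw [natCard_layer_succ_eq p (j + 1), sq, natCard_layer_succ_eq p j]
  set e₁ := (xPowSubmodule p (M ⧸ modPSubmodule p M) (j + 2)).toAddSubgroup.relIndex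
    (xPowSubmodule p (M ⧸ modPSubmodule p M) (j + 1)).toAddSubgroup
  set e₀ := (xPowSubmodule p (M ⧸ modPSubmodule p M) (j + 1)).toAddSubgroup.relIndex
    (xPowSubmodule p (M ⧸ modPSubmodule p M) j).toAddSubgroup
  set c₀ := Nat.card (M ⧸ (towerIdeal p j • ⊤ : Submodule (IwasawaAlgebra p) M))
  calc e₁ * (e₀ * c₀) * c₀ = e₁ * (e₀ * c₀ * c₀) := by ring
    _ ≤ e₀ * (e₀ * c₀ * c₀) := Nat.mul_le_mul_right _ hle
    _ = e₀ * c₀ * (e₀ * c₀) := by ring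

omit [Module.Finite (IwasawaAlgebra p) M] in
/-- **The `p`-dichotomy per step**: either `#(X/(p,T^{j+1})X) = #(X/(p,T^j)X)` (the filtration stalls at `j`) or
`p · #(X/(p,T^j)X) ∣ #(X/(p,T^{j+1})X)` (a proper step of a group killed by `p` has index divisible by `p`). [folklore] -/
theorem natCard_layer_succ_eq_or_dvd (j : ℕ) :
    Nat.card (M ⧸ (towerIdeal p (j + 1) • ⊤ : Submodule (IwasawaAlgebra p) M)) =
        Nat.card (M ⧸ (towerIdeal p j • ⊤ : Submodule (IwasawaAlgebra p) M)) ∨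
      p * Nat.card (M ⧸ (towerIdeal p j • ⊤ : Submodule (IwasawaAlgebra p) M)) ∣
        Nat.card (M ⧸ (towerIdeal p (j + 1) • ⊤ : Submodule (IwasawaAlgebra p) M)) := by
  set N := M ⧸ modPSubmodule p M
  by_cases h : xPowSubmodule p N (j + 1) = xPowSubmodule p N j
  · left
    rw [natCard_layer_eq_index, natCard_layer_eq_index]
    exact congrArg (fun S : Submodule (IwasawaAlgebra p) N => S.toAddSubgroup.index) h
  · right
    have hlt : (xPowSubmodule p N (j + 1)).toAddSubgroup < (xPowSubmodule p N j).toAddSubgroup := by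
      refine lt_of_le_of_ne (fun x hx => xPowSubmodule_antitone p N (Nat.le_succ j) hx) fun h' => h ?_
      exact Submodule.toAddSubgroup_injective h'
    have hp' := dvd_relIndex_of_lt p (nsmul_p_quotient_modP p (M := M)) hlt
    rw [natCard_layer_succ_eq]
    exact mul_dvd_mul hp' (dvd_refl _)

/-- The dichotomy in inequality form: a step is a stall or multiplies the count by at least `p`. [folklore] -/
theorem natCard_layer_succ_eq_or_le (j : ℕ) :
    Nat.card (M ⧸ (towerIdeal p (j + 1) • ⊤ : Submodule (IwasawaAlgebra p) M)) =
        Nat.card (M ⧸ (towerIdeal p j • ⊤ : Submodule (IwasawaAlgebra p) M)) ∨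
      p * Nat.card (M ⧸ (towerIdeal p j • ⊤ : Submodule (IwasawaAlgebra p) M)) ≤
        Nat.card (M ⧸ (towerIdeal p (j + 1) • ⊤ : Submodule (IwasawaAlgebra p) M)) :=
  (natCard_layer_succ_eq_or_dvd p j).imp_right fun h => Nat.le_of_dvd (natCard_layer_pos p (j + 1)) h

/-- **A stall FREEZES the staircase at the exact value `#(X/pX)`**: if `#(X/(p,T^{j+1})X) = #(X/(p,T^j)X)` then `T^j` kills
`X/pX` (Nakayama), so `X/pX` is finite and `#(X/(p,T^i)X) = #(X/pX)` for every `i ≥ j`. [folklore] -/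
theorem finite_modP_and_natCard_eq_of_stall {j : ℕ}
    (h : Nat.card (M ⧸ (towerIdeal p (j + 1) • ⊤ : Submodule (IwasawaAlgebra p) M)) =
      Nat.card (M ⧸ (towerIdeal p j • ⊤ : Submodule (IwasawaAlgebra p) M))) :
    Finite (M ⧸ modPSubmodule p M) ∧ ∀ i, j ≤ i →
      Nat.card (M ⧸ (towerIdeal p i • ⊤ : Submodule (IwasawaAlgebra p) M)) = Nat.card (M ⧸ modPSubmodule p M) := by
  set N := M ⧸ modPSubmodule p M
  -- the index `e_j` is `1`, so the two submodules coincide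
  have hone : (xPowSubmodule p N (j + 1)).toAddSubgroup.relIndex (xPowSubmodule p N j).toAddSubgroup = 1 := by
    have h1 := natCard_layer_succ_eq p (M := M) j
    rw [h] at h1
    have hpos := natCard_layer_pos p (M := M) j
    -- `c = e * c` with `c > 0`
    have : (xPowSubmodule p N (j + 1)).toAddSubgroup.relIndex (xPowSubmodule p N j).toAddSubgroup *
        Nat.card (M ⧸ (towerIdeal p j • ⊤ : Submodule (IwasawaAlgebra p) M)) =
        1 * Nat.card (M ⧸ (towerIdeal p j • ⊤ : Submodule (IwasawaAlgebra p) M)) := by rw [one_mul]; exact h1.symm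
    exact Nat.eq_of_mul_eq_mul_right hpos this
  have heq : xPowSubmodule p N (j + 1) = xPowSubmodule p N j := by
    refine le_antisymm (xPowSubmodule_antitone p N (Nat.le_succ j)) ?_
    intro x hx
    exact (AddSubgroup.relIndex_eq_one.mp hone) hx
  have hbot : ∀ i, j ≤ i → xPowSubmodule p N i = ⊥ := fun i hi => xPowSubmodule_eq_bot_of_le p heq hi
  haveI : Finite (N ⧸ xPowSubmodule p N j) := by
    haveI := finite_quotient_towerIdeal p (M := M) j
    exact Finite.of_equiv _ (quotientTowerIdealEquiv p (M := M) j).toEquiv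
  have hN : Finite N := Finite.of_equiv _ (Submodule.quotEquivOfEqBot _ (hbot j le_rfl)).toEquiv
  refine ⟨hN, fun i hi => ?_⟩
  rw [Nat.card_congr (quotientTowerIdealEquiv p (M := M) i).toEquiv,
    Nat.card_congr (Submodule.quotEquivOfEqBot _ (hbot i hi)).toEquiv]

end Layers

end Summit.BirchSwinnertonDyer.BirchSwinnertonDyer.Theorems.SignedMuAtTwo.TowerStaircase
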